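import Summits.HodgeConjecture.HodgeConjecture.Theorems.F0LD2SoftRoadBricks
import Literature.NumberTheory.GelbartRogawski1991.LocalDoubledTwistedSectionEigenlaw
import HarnessLib

/-!
# Crux `HLiu418`, line LD2 — the CUT of the soft-road target (Z) into (Z-Λ) «a centre type gives a non-zero `U(W ⊕ −W)`-invariant functional»
# and (Z-van) «every `U(W ⊕ −W)`-invariant functional vanishes» (statement-only defs leaf)

Cell `hodgecm-mathlib` (D-0151), half A line LD2, seat B-p04 (g45) for LD2-plan (g3) (DEALS #16 (1), 2026-09-02).  Crux hLiu418 =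
`stmt-HodgeConjecture-24832`; leaf `Cruxes/HLiu418/Lines/F0_P6LD_StubS1bFactsOrganRoad.lean` ED. 7, organ stub `stub_organ_lineTypes₁`; soft-road junction
bricks ★ `Theorems/F0LD2SoftRoadBricks.lean` (A-p13 (g40)), whose brick (Z) `AnisotropicPlaneCentreTypeVanishes` is cut here into TWO `Prop`s over the SAME
objects, and NOTHING ELSE (0 theorems, 0 `sorry`, no instance, no notation):

* `ZLambda` (Z-Λ) — for a CM field `L`, a non-split finite place `v` of `L⁺`, Haar data `μ`, a hermitian plane `T` (`2 × 2` symmetric over `L⁺`, unit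
  determinant), a splitting Hecke character `χ`, a centre line `J′` and the centre character `e′ = ∏_w χ_w ∘ det` (open kernel): IF `e′` occurs in
  Kudla's CM Weil representation `ω_T ∘ s_T` of `U(T)(L⁺_v)` restricted to the centre `z ↦ z·1` (`Coinv_{e′} ≠ 0`), THEN there is a NON-ZERO linear
  functional `Λ` on `𝒮(L⁺_v^{2+2})` invariant under the TWISTED SECTION `s′ h = μ_v(det h)⁻¹ • ω^𝔻(s^𝔻(h ⊗ₖ 1_V))` of the standard doubled line
  `G₁ = U(⟨1⟩ ⊕ ⟨−1⟩)(L⁺_v)` (★ `LocalDoubledTwistedSectionEigenlaw`, inline, `ι := kronLoc`; `s^𝔻 = (localSplittingDatumCM L v μ 2 …).localSplitting`).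
  Road (B-p04): an `e′`-eigenvector `f₁` (★ `TwistedCoinv.exists_mem_weightSpace_mk_eq`), `Φ := f₁ ⊠ f₂` with `λ′(Φ) = 1` (★ non-degeneracy
  `eq_zero_of_forall_apply_zero_toRep_boxSB_left_eq_zero`), `Φ` is `s′(inl U(W))`-fixed (★ `kronLoc_inlLoc`, ★ `toRep_undoubleLoc_boxSB`, `μ_v(det(z ⊕ 1)) =
  e′(z)`), and the dock ★ `exists_invariant_functional_of_fixedVector_cm` with ★ `twistedSection_mul` ∕ `apply_zero_toRep_twistedSection_kronLoc_eq_modularCharacter_mul`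
  ∕ `continuous_apply_twistedSection_kronLoc`.
* `ZVan` (Z-van) — for an ANISOTROPIC plane `T = T₁ ⊕ αT₁` (`(−α⁻¹, δ²)_v = −1`) at a non-split `v`: EVERY linear functional on `𝒮(L⁺_v^{2+2})` invariant
  under that twisted section is ZERO.  Road (A-p19 (g31)): the Siegel unipotents act through `ψ(b·Q_T)` with `Q_T` anisotropic and the Weyl element through a
  Fourier operator (★ `leraySection_deltaLagrangian_apply_eq_conj_unipOpPi`, ★ `localOmega_apply_eq_smul_conj_fourierOpPi`, group-side shapes (GRP)), so ★
  `functional_eq_zero_of_forall_unipOpPi_eq_of_fourierOpPi` applies.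
The closer `anisotropicPlaneCentreTypeVanishes_of_zBricks : ZLambda → ZVan → AnisotropicPlaneCentreTypeVanishes` (by contradiction) is the separate
theorems-only file `Theorems/F0LD2AnisotropicPlaneOfZBricks.lean`.  Binder discipline: the `Coinv` hypothesis of `ZLambda` is (Z)'s conclusion VERBATIM (rank
written `1 + 1`); the twisted section is ★ FILE B's VERBATIM (rank written `2`, `kronLoc … 2 (T := T) (J := T.map …) rfl rfl hJD₁`); the two ranks agree
definitionally.

HONEST LABEL.  Definitions only; nothing is asserted.  HC_CM is proved only modulo the 7 printed citations (2 remaining: hLiu418 = stmt-HodgeConjecture-24832,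
h413 = stmt-HodgeConjecture-24833) until rung 0 closes; count-neutral.  Locators (not cited facts): Gelbart–Rogawski 1991 §3.2 (3.2.2)–(3.2.3) p. 457;
Harris–Kudla–Sweet 1996 §6 Thm. 6.1; Mœglin–Vignéras–Waldspurger 1987 Chap. 3 §IV.4; Kudla 1994 §3 Thm. 3.1; Weil 1965 §9.
-/

set_option autoImplicit false
set_option linter.dupNamespace false

noncomputable section

open scoped Matrix Kronecker
open NumberField IsDedekindDomain MeasureTheory MeasureTheory.Measure
open Literature.NumberTheory Literature.NumberTheory.Automorphic Literature.NumberTheory.Automorphic.UnitaryGroup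
open Literature.RepresentationTheory Literature.RepresentationTheory.HeisenbergGroup Literature.RepresentationTheory.TwistedCoinv
open Literature.NumberTheory.GelbartRogawski1991 Literature.NumberTheory.GelbartRogawski1991.UnitaryDualPair
open Literature.NumberTheory.GelbartRogawski1991.UnitaryDualPair.WeilCoinv
open Literature.NumberTheory.GelbartRogawski1991.UnitaryDualPair.LocalSplitting
open Literature.NumberTheory.GelbartRogawski1991.GRConstruction
open Literature.NumberTheory.Weil1964
open Literature.NumberTheory.GaloisRepresentations Literature.RepresentationTheory.HarrisKudlaSweet1996
open Literature.RepresentationTheory.MoeglinVignerasWaldspurger1987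
open Literature.NumberTheory.QuadraticForms

namespace Summit.HodgeConjecture.HodgeConjecture.Cruxes.HLiu418.F0LD2SoftRoadJunction

/-! ## §1 The two bricks of the cut (Z) ⟸ (Z-Λ) ∧ (Z-van) -/

set_option synthInstance.maxHeartbeats 400000 in
set_option maxHeartbeats 4000000 in -- block-currency terms + the doubled CM datum's telescope
/-- (Z-Λ) **a centre type of the plane's CM Weil representation yields a NON-ZERO linear functional on `𝒮(L⁺_v^{2+2})` invariant under the twisted
section `s′ h = μ_v(det h)⁻¹ • ω^𝔻(s^𝔻(h ⊗ₖ 1_V))` of the standard doubled line `U(⟨1⟩ ⊕ ⟨−1⟩)(L⁺_v)`** (no anisotropy needed).  Why it might fail: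
only through a normalisation slip (the twist `μ_v(det ·)⁻¹` must cancel the centre type `e′` on `inl U(W)`). (locator, not a cited fact: GelbartRogawski1991,
§3.2 (3.2.2)–(3.2.3) p. 457) (locator, not a cited fact: Weil 1965 §9) -/
def ZLambda : Prop :=
    ∀ (L : Type) [Field L] [NumberField L] [IsCMField L] (v : HeightOneSpectrum (𝓞 (maximalRealSubfield L)))
    [MeasurableSpace (v.adicCompletion (maximalRealSubfield L))] [BorelSpace (v.adicCompletion (maximalRealSubfield L))]
    (μ : Measure (v.adicCompletion (maximalRealSubfield L))) [μ.IsAddHaarMeasure]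
    (hE : IsField (UnitaryGroup.LocalRing L v))
    {T : Matrix (Fin (1 + 1)) (Fin (1 + 1)) (maximalRealSubfield L)} (hTs : T.IsSymm) (hTd : IsUnit T.det)
    {J : Matrix (Fin (1 + 1)) (Fin (1 + 1)) L} (hJ : J = T.map (algebraMap (maximalRealSubfield L) L))
    (χ : HeckeCharacter L) (hχ : IsSplittingChar L 1 χ) {J₁ : Matrix (Fin 1) (Fin 1) L} {J' : Matrix (Fin 1) (Fin 1) L} (hJ'0 : J' 0 0 ≠ 0)
    (e' : localPi L (IsCMField.complexConj L) 1 J' v →* ℂˣ) (he'o : IsOpen (e'.ker : Set (localPi L (IsCMField.complexConj L) 1 J' v)))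
    (he' : ∀ z, e' z = ∏ w' : PlacesOver L v, χ.localComponent w'.1 (Matrix.GeneralLinearGroup.det
      (((UnitaryGroup.localCenter L (IsCMField.complexConj L) 1 J₁ J' hJ'0 v z : localPi L (IsCMField.complexConj L) 1 J₁ v) :
        LocalGLPi L 1 v) w')))
    {JD₁ : Matrix (Fin (1 + 1)) (Fin (1 + 1)) L}
    (hJD₁ : JD₁ = (gramD (maximalRealSubfield L) 1 1).map (algebraMap (maximalRealSubfield L) L)),
    Nontrivial (Coinv ((((MpPsi.toRep (localSchrodinger (maximalRealSubfield L) (1 + 1) T v)).comp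
        (localSplittingCMWith L (1 + 1) hTs hTd hJ χ hχ v μ))).comp
        (UnitaryGroup.localCenter L (IsCMField.complexConj L) (1 + 1) J J' hJ'0 v)) e') →
    ∃ Λ : SchwartzBruhat (Fin (2 + 2) → v.adicCompletion (maximalRealSubfield L)) →ₗ[ℂ] ℂ, Λ ≠ 0 ∧
      ∀ (g : UnitaryGroup.localPi L (IsCMField.complexConj L) (1 + 1) JD₁ v)
        (Ψ : SchwartzBruhat (Fin (2 + 2) → v.adicCompletion (maximalRealSubfield L))),
        Λ ((((localMu L χ v (Matrix.GeneralLinearGroup.det ((localPiEquiv L (IsCMField.complexConj L) (1 + 1) JD₁ v g).1)))⁻¹ : ℂˣ) : ℂ) •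
          MpPsi.toRep (localSchrodinger (maximalRealSubfield L) (2 + 2) (gramD (maximalRealSubfield L) 2 T) v)
            ((localSplittingDatumCM L v μ 2 hTs hTd rfl χ hχ).localSplitting
              (kronLoc (maximalRealSubfield L) L (IsCMField.complexConj L) v 2 (T := T) (J := T.map (algebraMap (maximalRealSubfield L) L))
                rfl rfl hJD₁ g)) Ψ) = Λ Ψ

set_option synthInstance.maxHeartbeats 400000 in
set_option maxHeartbeats 4000000 in -- the doubled CM datum's telescope
/-- (Z-van) **for an ANISOTROPIC hermitian plane `T = T₁ ⊕ αT₁` (`(−α⁻¹, δ²)_v = −1`) at a non-split place, every linear functional on `𝒮(L⁺_v^{2+2})`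
invariant under the twisted section `s′ h = μ_v(det h)⁻¹ • ω^𝔻(s^𝔻(h ⊗ₖ 1_V))` of the standard doubled line is ZERO** (the Siegel unipotents act by the
anisotropic characters `ψ(b·Q_T)`, the Weyl element by a Fourier operator).  Why it might fail: an ISOTROPIC plane carries the invariant functional
«integrate over the null cone»; the hypothesis `hclass` excludes it. (locator, not a cited fact: MoeglinVignerasWaldspurger1987, Chap. 3 §IV.4)
(locator, not a cited fact: HarrisKudlaSweet1996, §6 Thm. 6.1) -/
def ZVan : Prop :=
    ∀ (L : Type) [Field L] [NumberField L] [IsCMField L] (v : HeightOneSpectrum (𝓞 (maximalRealSubfield L)))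
    [MeasurableSpace (v.adicCompletion (maximalRealSubfield L))] [BorelSpace (v.adicCompletion (maximalRealSubfield L))]
    (μ : Measure (v.adicCompletion (maximalRealSubfield L))) [μ.IsAddHaarMeasure]
    (hE : IsField (UnitaryGroup.LocalRing L v))
    {T₁ T₂ : Matrix (Fin 1) (Fin 1) (maximalRealSubfield L)} (hT₁ : T₁.IsSymm) (hT₂ : T₂.IsSymm) (hT₁d : IsUnit T₁.det) (hT₂d : IsUnit T₂.det)
    (α : (maximalRealSubfield L)ˣ) (hTT' : T₂ = (α : maximalRealSubfield L) • T₁)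
    (hclass : hilbertSymbol (v.adicCompletion (maximalRealSubfield L))
      ((-(α : maximalRealSubfield L)⁻¹ : maximalRealSubfield L) : v.adicCompletion (maximalRealSubfield L))
      ((imagUnitSq L : maximalRealSubfield L) : v.adicCompletion (maximalRealSubfield L)) = -1)
    {T : Matrix (Fin (1 + 1)) (Fin (1 + 1)) (maximalRealSubfield L)} (hT : T = UnitaryGroup.finSum 1 1 T₁ T₂) (hTs : T.IsSymm) (hTd : IsUnit T.det)
    (χ : HeckeCharacter L) (hχ : IsSplittingChar L 1 χ)
    {JD₁ : Matrix (Fin (1 + 1)) (Fin (1 + 1)) L}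
    (hJD₁ : JD₁ = (gramD (maximalRealSubfield L) 1 1).map (algebraMap (maximalRealSubfield L) L))
    (Λ : SchwartzBruhat (Fin (2 + 2) → v.adicCompletion (maximalRealSubfield L)) →ₗ[ℂ] ℂ),
    (∀ (g : UnitaryGroup.localPi L (IsCMField.complexConj L) (1 + 1) JD₁ v)
        (Ψ : SchwartzBruhat (Fin (2 + 2) → v.adicCompletion (maximalRealSubfield L))),
        Λ ((((localMu L χ v (Matrix.GeneralLinearGroup.det ((localPiEquiv L (IsCMField.complexConj L) (1 + 1) JD₁ v g).1)))⁻¹ : ℂˣ) : ℂ) •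
          MpPsi.toRep (localSchrodinger (maximalRealSubfield L) (2 + 2) (gramD (maximalRealSubfield L) 2 T) v)
            ((localSplittingDatumCM L v μ 2 hTs hTd rfl χ hχ).localSplitting
              (kronLoc (maximalRealSubfield L) L (IsCMField.complexConj L) v 2 (T := T) (J := T.map (algebraMap (maximalRealSubfield L) L))
                rfl rfl hJD₁ g)) Ψ) = Λ Ψ) →
    Λ = 0

end Summit.HodgeConjecture.HodgeConjecture.Cruxes.HLiu418.F0LD2SoftRoadJunction

end
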